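import Summits.Ventures.Crystal3D.Theorems.StickyWulffConstantPolycrystalWulffBoundMultiBodyChimera
import Summits.Ventures.Crystal3D.Theorems.StickyWulffConstantPolycrystalWulffBoundZoneChimera
import Summits.Ventures.Crystal3D.Theorems.StickyWulffConstantPolycrystalWulffBoundTwinCapReflect
import Summits.Ventures.Crystal3D.Theorems.StickyWulffConstantPolycrystalWulffBoundSeparated

/-!
# `PolycrystalWulffBound`, general single-axis rung — step 1: the SLIDE CHIMERA lower bound
# (line `PolyDensity`, crux `stmt-Ventures-19482`)

Route `StickyWulffConstant`, venture `Summits/Ventures/Crystal3D`, second prover lane (poly-p2, gen 10).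
Pieces `G_f` (measurable, pairwise disjoint) with frames pairwise satisfying the crux's clause `Ax m`
(every body is `B₀ = W(A f₀)` or `R_m '' B₀`), a horizontal nearest-neighbour bond `u` of every
lattice (`‖u‖ = 1`, `u ⊥ m`, `u ∈ A_f Λ₀`, `R_u (A_f Λ₀) = A_f Λ₀`) and the unit `w ⊥ m, u` (a `⟨112⟩`
direction).  SEPARATION: points of pieces with DIFFERENT bodies never lie on a common line parallel to
`w` at distance `≤ r·(2/√6)`.  Then `|⋃ G_f|^{1/3} + r·32^{1/3} ≤ |C|^{1/3}` for every measurable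
`C ⊇ ⋃_f (G_f + r·W(A_f))` (`slide_chimera_lower`) — NO zone condition, walls of any directions.
Engine `Chimera.chimera3_multiBody_brunnMinkowski` (`…MultiBodyChimera`) in the coordinates
`(⟪u,·⟫, ⟪w,·⟫, ⟪m,·⟫)`: the `w`-fibres of `R_m B₀ = R_w B₀` are the reflected fibres of `B₀`, i.e.
translates by `−(lo + hi)`, `|lo + hi| ≤ r·2/√6` (`cruxWulffBody_chord_offset_le`, `…TwinCapReflect`).
In the rung (step 2) the separation is bought by trimming (`…LineTrim`): the wall charge.
WHAT THIS IS NOT: the rung; the crux is not claimed.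
-/

noncomputable section

open scoped BigOperators InnerProductSpace ENNReal Pointwise
open MeasureTheory Set

namespace Summit.Ventures.Crystal3D.Theorems

open Summit.Ventures.Crystal3D.Cruxes.TextureLiminf.TexShadow (E3)
open Literature.MathematicalPhysics.StatisticalMechanics (fccStacking barlowStacking IsHaggSeq)

/-- A nonempty compact convex set of reals is the closed interval between its infimum and supremum;
in particular it is symmetric about its midpoint: `y ∈ I ⇒ sInf I + sSup I − y ∈ I`. -/
theorem reflect_mem_of_compact_convex_real {I : Set ℝ} (hIc : IsCompact I) (hIv : Convex ℝ I)
    {y : ℝ} (hy : y ∈ I) : sInf I + sSup I - y ∈ I := by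
  have hne : I.Nonempty := ⟨y, hy⟩
  have hlo : sInf I ∈ I := hIc.sInf_mem hne
  have hhi : sSup I ∈ I := hIc.sSup_mem hne
  have h1 : sInf I ≤ y := csInf_le hIc.bddBelow hy
  have h2 : y ≤ sSup I := le_csSup hIc.bddAbove hy
  exact hIv.ordConnected.out hlo hhi ⟨by linarith, by linarith⟩

/-- **Slide chimera lower bound for single-axis twin textures with `w`-separated pieces.** -/
theorem slide_chimera_lower (m u w : E3) (hu : ‖u‖ = 1) (hw : ‖w‖ = 1) (hum : ⟪u, m⟫_ℝ = 0)
    (hwm : ⟪w, m⟫_ℝ = 0) (hwu : ⟪w, u⟫_ℝ = 0)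
    {k : ℕ} (G : Fin k → Set E3) (hG : ∀ f, MeasurableSet (G f))
    (hdisj : ∀ f g, f ≠ g → Disjoint (G f) (G g)) (A : Fin k → (E3 ≃ₗᵢ[ℝ] E3))
    (hAx : ∀ f g, ∃ (L : E3 ≃ₗᵢ[ℝ] E3) (s₁ s₂ : E3) (σ σ' : ℤ → ℤ), IsHaggSeq σ ∧ IsHaggSeq σ' ∧
      L (EuclideanSpace.single (2 : Fin 3) (1 : ℝ)) = m ∧
      A f '' fccStacking 1 (Real.sqrt (2 / 3)) ⊆
        (fun q => L q + s₁) '' barlowStacking 1 (Real.sqrt (2 / 3)) σ ∧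
      A g '' fccStacking 1 (Real.sqrt (2 / 3)) ⊆
        (fun q => L q + s₂) '' barlowStacking 1 (Real.sqrt (2 / 3)) σ')
    (hbond : ∀ f, u ∈ A f '' fccStacking 1 (Real.sqrt (2 / 3)))
    (hmir : ∀ f, (ℝ ∙ u)ᗮ.reflection '' (A f '' fccStacking 1 (Real.sqrt (2 / 3))) =
      A f '' fccStacking 1 (Real.sqrt (2 / 3)))
    {r : ℝ} (hr : 0 < r)
    (hsep : ∀ f g, {y : E3 | ∀ ν : E3, ⟪y, ν⟫_ℝ ≤ Real.sqrt 2 / 4 *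
        ∑ᶠ w ∈ {w | w ∈ fccStacking 1 (Real.sqrt (2 / 3)) ∧ ‖w‖ = 1}, |⟪w, (A f).symm ν⟫_ℝ|} ≠
      {y : E3 | ∀ ν : E3, ⟪y, ν⟫_ℝ ≤ Real.sqrt 2 / 4 *
        ∑ᶠ w ∈ {w | w ∈ fccStacking 1 (Real.sqrt (2 / 3)) ∧ ‖w‖ = 1}, |⟪w, (A g).symm ν⟫_ℝ|} →
      ∀ x ∈ G f, ∀ t : ℝ, |t| ≤ r * (2 / Real.sqrt 6) → x + t • w ∉ G g)
    (h0 : volume (⋃ f, G f) ≠ 0) (htop : volume (⋃ f, G f) ≠ ⊤)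
    {C : Set E3} (hC : MeasurableSet C)
    (hsub : ∀ f, ∀ x ∈ G f,
      ∀ y ∈ {y : E3 | ∀ ν : E3, ⟪y, ν⟫_ℝ ≤ Real.sqrt 2 / 4 *
        ∑ᶠ w ∈ {w | w ∈ fccStacking 1 (Real.sqrt (2 / 3)) ∧ ‖w‖ = 1}, |⟪w, (A f).symm ν⟫_ℝ|},
      x + r • y ∈ C) :
    volume (⋃ f, G f) ^ ((3 : ℕ)⁻¹ : ℝ) + ENNReal.ofReal r * (ENNReal.ofReal 32) ^ ((3 : ℕ)⁻¹ : ℝ) ≤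
      volume C ^ ((3 : ℕ)⁻¹ : ℝ) := by
  classical
  set e₂ : E3 := EuclideanSpace.single (2 : Fin 3) (1 : ℝ) with he₂
  set E' : Set E3 := ⋃ f, G f with hE'
  obtain ⟨x₀, hx₀⟩ := nonempty_of_measure_ne_zero h0
  obtain ⟨f₀, -⟩ := mem_iUnion.1 hx₀
  -- bodies
  set Bd : Fin k → Set E3 := fun f => {y : E3 | ∀ ν : E3, ⟪y, ν⟫_ℝ ≤ Real.sqrt 2 / 4 *
    ∑ᶠ w ∈ {w | w ∈ fccStacking 1 (Real.sqrt (2 / 3)) ∧ ‖w‖ = 1}, |⟪w, (A f).symm ν⟫_ℝ|} with hBd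
  set B₀ : Set E3 := Bd f₀ with hB₀
  have hm : ‖m‖ = 1 := by
    obtain ⟨L, -, -, -, -, -, -, hLm, -, -⟩ := hAx f₀ f₀
    rw [← hLm, LinearIsometryEquiv.norm_map, he₂, PiLp.norm_single, norm_one]
  set Rm : E3 ≃ₗᵢ[ℝ] E3 := (ℝ ∙ m)ᗮ.reflection with hRm
  set Ru : E3 ≃ₗᵢ[ℝ] E3 := (ℝ ∙ u)ᗮ.reflection with hRu
  have hRm_apply : ∀ x, Rm x = x - (2 * ⟪m, x⟫_ℝ) • m := reflection_orthogonal_unit_apply hm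
  have hRu_apply : ∀ x, Ru x = x - (2 * ⟪u, x⟫_ℝ) • u := reflection_orthogonal_unit_apply hu
  -- the orthonormal frame `(u, w, m)` and the transport `T x = (⟪u,x⟫, ⟪w,x⟫, ⟪m,x⟫)`
  set v : Fin 3 → E3 := ![u, w, m] with hv
  have hmu : ⟪m, u⟫_ℝ = 0 := by rw [real_inner_comm]; exact hum
  have hmw : ⟪m, w⟫_ℝ = 0 := by rw [real_inner_comm]; exact hwm
  have huw : ⟪u, w⟫_ℝ = 0 := by rw [real_inner_comm]; exact hwu
  have hvon : Orthonormal ℝ v := by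
    rw [orthonormal_iff_ite]
    intro i j
    fin_cases i <;> fin_cases j <;>
      simp [hv, hu, hw, hm, hum, hwm, hwu, hmu, hmw, huw]
  have hvsp : ⊤ ≤ Submodule.span ℝ (Set.range v) :=
    (hvon.linearIndependent.span_eq_top_of_card_eq_finrank' (by simp)).ge
  set b : OrthonormalBasis (Fin 3) ℝ E3 := OrthonormalBasis.mk hvon hvsp with hb
  have hbv : ∀ i, b i = v i := fun i => by rw [hb, OrthonormalBasis.coe_mk]
  set meq : E3 ≃ᵐ (Fin 3 → ℝ) := (MeasurableEquiv.toLp 2 (Fin 3 → ℝ)).symm with hmeq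
  set T : E3 ≃ᵐ (Fin 3 → ℝ) := b.repr.toHomeomorph.toMeasurableEquiv.trans meq with hT
  have hTapply : ∀ x, T x = meq (b.repr x) := fun x => rfl
  have hTi : ∀ x i, (T x) i = ⟪v i, x⟫_ℝ := by
    intro x i
    rw [hTapply, ← hbv, ← OrthonormalBasis.repr_apply_apply]
    rfl
  have hT0 : ∀ x, (T x) 0 = ⟪u, x⟫_ℝ := fun x => by rw [hTi]; rfl
  have hT1 : ∀ x, (T x) 1 = ⟪w, x⟫_ℝ := fun x => by rw [hTi]; rfl
  have hT2 : ∀ x, (T x) 2 = ⟪m, x⟫_ℝ := fun x => by rw [hTi]; rfl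
  have hTeq : ∀ x, T x = ![⟪u, x⟫_ℝ, ⟪w, x⟫_ℝ, ⟪m, x⟫_ℝ] := by
    intro x; ext i; fin_cases i; exacts [hT0 x, hT1 x, hT2 x]
  have hTmp : MeasurePreserving T volume volume :=
    b.repr.measurePreserving.trans (EuclideanSpace.volume_preserving_symm_measurableEquiv_toLp (Fin 3))
  have hTvol : ∀ X : Set E3, MeasurableSet X → volume (T '' X) = volume X := fun X hX => by
    rw [MeasurableEquiv.image_eq_preimage_symm]; exact hTmp.symm.measure_preimage hX.nullMeasurableSet
  have hTadd : ∀ x y : E3, T (x + y) = T x + T y := fun x y => by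
    rw [hTapply, hTapply, hTapply, map_add]; rfl
  have hTsmul : ∀ (c : ℝ) (x : E3), T (c • x) = c • T x := fun c x => by
    rw [hTapply, hTapply, map_smul]; rfl
  have hmemT : ∀ (X : Set E3) (z : Fin 3 → ℝ), z ∈ T '' X ↔ T.symm z ∈ X := fun X z => by
    rw [MeasurableEquiv.image_eq_preimage_symm, mem_preimage]
  have hTw : T w = ![0, 1, 0] := by
    rw [hTeq]
    simp only [huw, real_inner_self_eq_norm_sq, hw, one_pow, hmw]
  -- a point is `base + (w-coordinate) • w`
  have hline : ∀ x x' : E3, (T x) 0 = (T x') 0 → (T x) 2 = (T x') 2 →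
      x' = x + ((T x') 1 - (T x) 1) • w := by
    intro x x' h0 h2
    have hsum := b.sum_repr' (x' - x)
    rw [Fin.sum_univ_three, hbv, hbv, hbv] at hsum
    have h0' : ⟪v 0, x' - x⟫_ℝ = 0 := by
      show ⟪u, x' - x⟫_ℝ = 0
      rw [inner_sub_right, ← hT0, ← hT0, h0, sub_self]
    have h2' : ⟪v 2, x' - x⟫_ℝ = 0 := by
      show ⟪m, x' - x⟫_ℝ = 0
      rw [inner_sub_right, ← hT2, ← hT2, h2, sub_self]
    rw [h0', h2', zero_smul, zero_smul, zero_add, add_zero] at hsum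
    have hv1 : v 1 = w := rfl
    rw [hv1, inner_sub_right, ← hT1, ← hT1] at hsum
    rw [hsum, add_sub_cancel]
  -- the mirrors in transported coordinates
  have hTRm : ∀ x, T (Rm x) = ![(T x) 0, (T x) 1, -(T x) 2] := by
    intro x
    rw [hTeq, hTeq, hRm_apply]
    simp only [inner_sub_right, real_inner_smul_right, hum, hwm, real_inner_self_eq_norm_sq, hm]
    ext i; fin_cases i <;> simp
    ring
  have hTRu : ∀ x, T (Ru x) = ![-(T x) 0, (T x) 1, (T x) 2] := by
    intro x
    rw [hTeq, hTeq, hRu_apply]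
    simp only [inner_sub_right, real_inner_smul_right, hwu, hmu, real_inner_self_eq_norm_sq, hu]
    ext i; fin_cases i <;> simp
    ring
  have hTneg : ∀ x, T (-x) = ![-(T x) 0, -(T x) 1, -(T x) 2] := by
    intro x
    rw [hTeq, hTeq]
    simp only [inner_neg_right]
    ext i; fin_cases i <;> simp
  have hsymmRm : ∀ z, Rm (T.symm z) = T.symm ![z 0, z 1, -z 2] := fun z =>
    T.injective (by rw [hTRm, T.apply_symm_apply, T.apply_symm_apply])
  have hsymmRu : ∀ z, Ru (T.symm z) = T.symm ![-z 0, z 1, z 2] := fun z =>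
    T.injective (by rw [hTRu, T.apply_symm_apply, T.apply_symm_apply])
  have hsymmneg : ∀ z, -(T.symm z) = T.symm ![-z 0, -z 1, -z 2] := fun z =>
    T.injective (by rw [hTneg, T.apply_symm_apply, T.apply_symm_apply])
  have hsymm_add_w : ∀ (η ζ y : ℝ), T.symm ![η, y, ζ] = T.symm ![η, 0, ζ] + y • w := by
    intro η ζ y
    apply T.injective
    rw [hTadd, T.apply_symm_apply, T.apply_symm_apply, hTsmul, hTw]
    ext i; fin_cases i <;> simp
  have hbase_w : ∀ η ζ : ℝ, ⟪T.symm ![η, 0, ζ], w⟫_ℝ = 0 := by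
    intro η ζ
    rw [real_inner_comm, ← hT1, T.apply_symm_apply]
    rfl
  -- bodies: `B₀` or `Rm '' B₀`; symmetries of `B₀`
  have hbody : ∀ f, Bd f = B₀ ∨ Bd f = Rm '' B₀ := fun f => cruxWulffBody_eq_or_eq_reflection_image (hAx f₀ f)
  have hRuB₀ : Ru '' B₀ = B₀ := cruxWulffBody_image_eq_of_latticeSymm (hmir f₀)
  have hnegB₀ : -B₀ = B₀ := by rw [hB₀]; exact neg_cruxWulffBody_eq _
  have hB₀c : IsCompact B₀ := isCompact_cruxWulffBody _
  have hB₀v : Convex ℝ B₀ := convex_cruxWulffBody _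
  have hrB₀m : MeasurableSet (r • B₀) := (hB₀c.smul r).isClosed.measurableSet
  have hmem_rB₀_neg : ∀ x, x ∈ r • B₀ ↔ -x ∈ r • B₀ := by
    intro x
    conv_lhs => rw [← hnegB₀, Set.smul_set_neg, Set.mem_neg]
  have hmem_rB₀_Ru : ∀ x, x ∈ r • B₀ ↔ Ru x ∈ r • B₀ := by
    intro x
    constructor
    · intro hx
      obtain ⟨y, hy, rfl⟩ := Set.mem_smul_set.1 hx
      rw [map_smul]
      refine Set.smul_mem_smul_set ?_
      rw [← hRuB₀]; exact ⟨y, hy, rfl⟩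
    · intro hx
      obtain ⟨y, hy, hyx⟩ := Set.mem_smul_set.1 hx
      have : x = r • Ru y := by
        have := congrArg Ru hyx
        rw [Submodule.reflection_reflection, map_smul] at this
        exact this.symm
      rw [this]
      refine Set.smul_mem_smul_set ?_
      rw [← hRuB₀]; exact ⟨y, hy, rfl⟩
  have hmem_rRm : ∀ x, x ∈ r • (Rm '' B₀) ↔ Rm x ∈ r • B₀ := by
    intro x
    constructor
    · intro hx
      obtain ⟨_, ⟨y, hy, rfl⟩, rfl⟩ := Set.mem_smul_set.1 hx
      rw [map_smul, Submodule.reflection_reflection]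
      exact Set.smul_mem_smul_set hy
    · intro hx
      obtain ⟨y, hy, hyx⟩ := Set.mem_smul_set.1 hx
      have : x = r • Rm y := by
        have := congrArg Rm hyx
        rw [Submodule.reflection_reflection, map_smul] at this
        exact this.symm
      rw [this]
      exact Set.smul_mem_smul_set ⟨y, hy, rfl⟩
  set W₀ : Set (Fin 3 → ℝ) := T '' (r • B₀) with hW₀
  have hW₀m : MeasurableSet W₀ := (MeasurableEquiv.measurableSet_image _).2 hrB₀m
  -- the fibres of the transported twin body are reflected fibres of `W₀`
  have hfibRm : ∀ η y ζ : ℝ, (![η, y, ζ] : Fin 3 → ℝ) ∈ T '' (r • (Rm '' B₀)) ↔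
      (![η, -y, ζ] : Fin 3 → ℝ) ∈ W₀ := by
    intro η y ζ
    rw [hmemT, hmemT, hmem_rRm, hsymmRm, hmem_rB₀_neg, hsymmneg, hmem_rB₀_Ru, hsymmRu]
    simp
  -- the fibres of `W₀`: compact convex sets of reals, offsets `≤ r·2/√6`
  set I : ℝ → ℝ → Set ℝ := fun η ζ => {y : ℝ | (![η, y, ζ] : Fin 3 → ℝ) ∈ W₀} with hI
  have hI' : ∀ η ζ, I η ζ = {y : ℝ | T.symm ![η, 0, ζ] + y • w ∈ r • B₀} := by
    intro η ζ
    ext y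
    simp only [hI, mem_setOf_eq]
    rw [hmemT, hsymm_add_w]
  have hIc : ∀ η ζ, IsCompact (I η ζ) := by
    intro η ζ
    rw [hI' η ζ]
    have hcont : Continuous fun y : ℝ => T.symm ![η, 0, ζ] + y • w :=
      continuous_const.add (continuous_id.smul continuous_const)
    refine Metric.isCompact_of_isClosed_isBounded ((hB₀c.smul r).isClosed.preimage hcont) ?_
    obtain ⟨R, hR⟩ := (hB₀c.smul r).isBounded.subset_closedBall 0
    refine (Metric.isBounded_Icc (-(R + ‖T.symm ![η, 0, ζ]‖)) (R + ‖T.symm ![η, 0, ζ]‖)).subset ?_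
    intro y hy
    have h := mem_closedBall_zero_iff.1 (hR hy)
    have hyw : ‖y • w‖ = |y| := by rw [norm_smul, hw, mul_one, Real.norm_eq_abs]
    have : |y| ≤ R + ‖T.symm ![η, 0, ζ]‖ := by
      rw [← hyw]
      calc ‖y • w‖ = ‖(T.symm ![η, 0, ζ] + y • w) - T.symm ![η, 0, ζ]‖ := by rw [add_sub_cancel_left]
        _ ≤ ‖T.symm ![η, 0, ζ] + y • w‖ + ‖T.symm ![η, 0, ζ]‖ := norm_sub_le _ _
        _ ≤ R + ‖T.symm ![η, 0, ζ]‖ := by gcongr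
    exact ⟨by linarith [neg_abs_le y], by linarith [le_abs_self y]⟩
  have hIv : ∀ η ζ, Convex ℝ (I η ζ) := by
    intro η ζ
    rw [hI' η ζ]
    intro y₁ hy₁ y₂ hy₂ a c ha hc hac
    have h := (hB₀v.smul r) hy₁ hy₂ ha hc hac
    have e : a • (T.symm ![η, 0, ζ] + y₁ • w) + c • (T.symm ![η, 0, ζ] + y₂ • w) =
        T.symm ![η, 0, ζ] + (a * y₁ + c * y₂) • w := by
      have : a • (T.symm ![η, 0, ζ] + y₁ • w) + c • (T.symm ![η, 0, ζ] + y₂ • w) =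
          (a + c) • T.symm ![η, 0, ζ] + (a * y₁ + c * y₂) • w := by
        simp only [smul_add, add_smul, smul_smul]; abel
      rw [this, hac, one_smul]
    rw [e] at h
    simpa [smul_eq_mul] using h
  have hoff : ∀ η ζ, (I η ζ).Nonempty → |sInf (I η ζ) + sSup (I η ζ)| ≤ r * (2 / Real.sqrt 6) := by
    intro η ζ hne
    -- rescale to the chord of `B₀` through `r⁻¹ • base`
    set y₀ : E3 := T.symm ![η, 0, ζ] with hy₀
    have hy₀w : ⟪r⁻¹ • y₀, w⟫_ℝ = 0 := by rw [real_inner_smul_left, hy₀, hbase_w, mul_zero]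
    have hmemI : ∀ s : ℝ, s ∈ I η ζ ↔ r⁻¹ • y₀ + (r⁻¹ * s) • w ∈ B₀ := by
      intro s
      rw [hI' η ζ, mem_setOf_eq, Set.mem_smul_set_iff_inv_smul_mem₀ hr.ne', smul_add, smul_smul]
    have hloI : sInf (I η ζ) ∈ I η ζ := (hIc η ζ).sInf_mem hne
    have hhiI : sSup (I η ζ) ∈ I η ζ := (hIc η ζ).sSup_mem hne
    have hch := cruxWulffBody_chord_offset_le (hAx f₀ f₀) (hbond f₀) hu hum hw hwm hwu hy₀w
      (lo := r⁻¹ * sInf (I η ζ)) (hi := r⁻¹ * sSup (I η ζ))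
      ((hmemI _).1 hloI) ((hmemI _).1 hhiI)
      (by
        intro s hs
        have hs' : r * s ∈ I η ζ := by
          rw [hmemI, ← mul_assoc, inv_mul_cancel₀ hr.ne', one_mul]; exact hs
        have := csInf_le (hIc η ζ).bddBelow hs'
        rw [← inv_mul_le_iff₀ hr] at this
        · linarith [this]
        )
      (by
        intro s hs
        have hs' : r * s ∈ I η ζ := by
          rw [hmemI, ← mul_assoc, inv_mul_cancel₀ hr.ne', one_mul]; exact hs
        have := le_csSup (hIc η ζ).bddAbove hs'
        rw [← le_inv_mul_iff₀ hr] at this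
        · linarith [this])
    rw [← mul_add, abs_mul, abs_of_pos (inv_pos.2 hr)] at hch
    rwa [inv_mul_le_iff₀ hr] at hch
  -- the engine's data: pieces, bodies, offsets
  set Aj : Fin k → Set (Fin 3 → ℝ) := fun f => T '' G f with hAj
  set Wj : Fin k → Set (Fin 3 → ℝ) := fun f => T '' (r • Bd f) with hWj
  set δ : Fin k → ℝ → ℝ → ℝ := fun f ζ η =>
    if Bd f = B₀ then 0 else -(sInf (I η ζ) + sSup (I η ζ)) with hδ
  have hδabs : ∀ f ζ η, (I η ζ).Nonempty → |δ f ζ η| ≤ r * (2 / Real.sqrt 6) := by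
    intro f ζ η hne
    by_cases hf : Bd f = B₀
    · simp only [hδ, if_pos hf, abs_zero]; positivity
    · simp only [hδ, if_neg hf, abs_neg]; exact hoff η ζ hne
  have hδeq : ∀ f g, Bd f = Bd g → δ f = δ g := by
    intro f g hfg
    funext ζ η
    simp only [hδ, hfg]
  have hAjm : ∀ f, MeasurableSet (Aj f) := fun f => (MeasurableEquiv.measurableSet_image _).2 (hG f)
  have hAjdisj : ∀ f g, f ≠ g → Disjoint (Aj f) (Aj g) := by
    intro f g hfg
    rw [Set.disjoint_left]
    intro z hzf hzg
    rw [hAj, hmemT] at hzf hzg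
    exact Set.disjoint_left.1 (hdisj f g hfg) hzf hzg
  have hfib : ∀ f ζ η, ∀ y ∈ {y : ℝ | (![η, y, ζ] : Fin 3 → ℝ) ∈ W₀},
      y + δ f ζ η ∈ {y : ℝ | (![η, y, ζ] : Fin 3 → ℝ) ∈ Wj f} := by
    intro f ζ η y hy
    by_cases hf : Bd f = B₀
    · simp only [hδ, if_pos hf, add_zero, hWj, mem_setOf_eq, hf]
      exact hy
    · have hfB : Bd f = Rm '' B₀ := (hbody f).resolve_left hf
      simp only [hδ, if_neg hf, hWj, mem_setOf_eq, hfB]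
      rw [hfibRm]
      have h := reflect_mem_of_compact_convex_real (hIc η ζ) (hIv η ζ) (y := y) hy
      have e : -(y + -(sInf (I η ζ) + sSup (I η ζ))) = sInf (I η ζ) + sSup (I η ζ) - y := by ring
      rw [e]
      exact h
  have hsep' : ∀ f g, f ≠ g → ∀ a ∈ Aj f, ∀ a' ∈ Aj g, a 0 = a' 0 → a 2 = a' 2 → ∀ ζ η,
      a 1 - a' 1 ≠ δ g ζ η - δ f ζ η := by
    intro f g hfg a ha a' ha' h0 h2 ζ η
    rw [hAj] at ha ha'
    obtain ⟨x, hx, rfl⟩ := ha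
    obtain ⟨x', hx', rfl⟩ := ha'
    have hx'eq : x' = x + ((T x') 1 - (T x) 1) • w := hline x x' h0 h2
    by_cases hfg' : Bd f = Bd g
    · -- same body: the offsets agree and the points are distinct
      rw [hδeq f g hfg', sub_self]
      intro h
      have : x' = x := by rw [hx'eq, show (T x') 1 - (T x) 1 = 0 by linarith, zero_smul, add_zero]
      exact Set.disjoint_left.1 (hdisj f g hfg) hx (this ▸ hx')
    · -- different bodies: the points are `w`-separated by more than the offsets
      intro h
      have hne : (I η ζ).Nonempty ∨ ¬ (I η ζ).Nonempty := em _
      have hbound : |δ g ζ η - δ f ζ η| ≤ r * (2 / Real.sqrt 6) := by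
        rcases hne with hne | hne
        · -- one of the two offsets is `0`
          by_cases hf : Bd f = B₀
          · have : δ f ζ η = 0 := by simp only [hδ, if_pos hf]
            rw [this, sub_zero]; exact hδabs g ζ η hne
          · have hg : Bd g = B₀ := by
              rcases hbody g with h' | h'
              · exact h'
              · exact absurd (((hbody f).resolve_left hf).trans h'.symm) hfg'
            have : δ g ζ η = 0 := by simp only [hδ, if_pos hg]
            rw [this, zero_sub, abs_neg]; exact hδabs f ζ η hne
        · -- empty fibre: both offsets vanish
          have hI0 : I η ζ = ∅ := Set.not_nonempty_iff_eq_empty.1 hne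
          have : ∀ f', δ f' ζ η = 0 := by
            intro f'
            by_cases hf' : Bd f' = B₀
            · simp only [hδ, if_pos hf']
            · simp only [hδ, if_neg hf', hI0, Real.sInf_empty, Real.sSup_empty, add_zero, neg_zero]
          rw [this, this, sub_self, abs_zero]; positivity
      have ht : |(T x') 1 - (T x) 1| ≤ r * (2 / Real.sqrt 6) := by
        rw [abs_sub_comm, h]; exact hbound
      exact hsep f g hfg' x hx _ ht (hx'eq ▸ hx')
  have hsub' : ∀ f, ∀ a ∈ Aj f, ∀ w' ∈ Wj f, a + w' ∈ T '' C := by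
    intro f a ha w' hw'
    rw [hAj] at ha
    rw [hWj] at hw'
    obtain ⟨x, hx, rfl⟩ := ha
    obtain ⟨v', hv', rfl⟩ := hw'
    obtain ⟨y', hy', rfl⟩ := Set.mem_smul_set.1 hv'
    refine ⟨x + r • y', hsub f x hx y' hy', ?_⟩
    rw [hTadd]
  have hE'm : MeasurableSet E' := MeasurableSet.iUnion hG
  have hAjU : (⋃ f, Aj f) = T '' E' := by rw [hE', image_iUnion]
  have hvW₀ : volume W₀ = ENNReal.ofReal (r ^ 3) * ENNReal.ofReal 32 := by
    rw [hW₀, hTvol _ hrB₀m, Measure.addHaar_smul, finrank_euclideanSpace, Fintype.card_fin, hB₀, hBd,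
      volume_cruxWulffBody, abs_of_pos (pow_pos hr 3)]
  have hchim := Chimera.chimera3_multiBody_brunnMinkowski Aj Wj (W₀ := W₀) (C := T '' C) δ hAjm
    ((MeasurableEquiv.measurableSet_image _).2 hC) hW₀m hAjdisj hfib hsep' hsub'
    (by rw [hAjU, hTvol _ hE'm]; exact h0) (by rw [hAjU, hTvol _ hE'm]; exact htop)
    (by
      rw [hvW₀]
      exact mul_ne_zero (ENNReal.ofReal_pos.2 (by positivity)).ne' (ENNReal.ofReal_pos.2 (by norm_num)).ne')
    (by
      rw [hvW₀]
      exact ENNReal.mul_ne_top ENNReal.ofReal_ne_top ENNReal.ofReal_ne_top)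
  have hroot : (ENNReal.ofReal (r ^ 3) * ENNReal.ofReal 32) ^ ((3 : ℕ)⁻¹ : ℝ) =
      ENNReal.ofReal r * ENNReal.ofReal 32 ^ ((3 : ℕ)⁻¹ : ℝ) := by
    rw [ENNReal.mul_rpow_of_nonneg _ _ (by positivity), ENNReal.ofReal_rpow_of_nonneg (by positivity)
      (by positivity), Real.pow_rpow_inv_natCast hr.le (by norm_num)]
  rw [hAjU, hTvol _ hE'm, hTvol _ hC, hvW₀, hroot] at hchim
  exact hchim

end Summit.Ventures.Crystal3D.Theorems

end
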